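import Summits.SmoothPoincare4.SmoothPoincare4.Theorems.SblfDescentRungOneHelperFoldNFOfFrame
import Summits.SmoothPoincare4.SmoothPoincare4.Theorems.SblfDescentRungOneHelperFoldNFFrameReduction
import Summits.SmoothPoincare4.SmoothPoincare4.Theorems.SblfDescentRungOneHelperFoldNFTimelike
import HarnessLib

/-!
# The `S¹`-parametric fold normal form of the round circle, from the untwistedness field

Helper `helper_foldNF_of_timelike` of stub `helper_sliceGluing_foldNormalForm`, line `Sketch`,
crux `SblfDescent.RungOne`.

(Crux item stmt-SmoothPoincare4-18531; skeleton `Cruxes/RungOne/Lines/Sketch.lean`.)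

Final assembly of the layered proof of the registered stub `helper_sliceGluing_foldNormalForm`
(the fold normal form `f (ν (u, x)) = (√(1 - s²) u, v₂ s)`, `s = x₀² + x₁² - x₂²`, of a
genus-one Lefschetz-free SBLF about its round circle) CONDITIONALLY on its one remaining input,
the residual `helper_foldNF_timelike` (a continuous `1`-periodic field of timelike vectors for
the page Hessians of the height along a tube about the round circle = the untwistedness of the
round `1`-handle, Baykur–Kamada 2015, §2):
`helper_foldNF_ofFrame ∘ helper_foldNF_frame_of_periodicFrame ∘ helper_foldNF_periodicFrame_of_timelike`.

## References

* R. İ. Baykur, S. Kamada, *Classification of broken Lefschetz fibrations with small fiber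
  genera*, J. Math. Soc. Japan 67 (2015), §2, §5. [BaykurKamada2015]
* M. W. Hirsch, *Differential Topology*, GTM 33 (1976), Ch. 6 §1. [HirschDT1976]
-/

set_option linter.dupNamespace false

noncomputable section

open scoped Manifold ContDiff Topology RealInnerProductSpace
open Set Function Filter Metric Literature.Topology.FourManifolds
  Literature.AlgebraicTopology.SingularHomology

namespace Summit.SmoothPoincare4.SmoothPoincare4.Cruxes.RungOne.Sketch

/-- Local notation: `𝔼 n` is the model Euclidean space `EuclideanSpace ℝ (Fin n)`. -/
local notation "𝔼 " n:arg => EuclideanSpace ℝ (Fin n)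

/-- Local notation: `𝕊²`, the unit sphere of `ℝ³`. -/
local notation "𝕊²" => (Metric.sphere (0 : EuclideanSpace ℝ (Fin 3)) (1 : ℝ))

attribute [local instance] Literature.Topology.FourManifolds.fact_finrank_euclideanSpace_succ

/-- **The fold normal form of the round circle from the untwistedness field.**  If along every
tube about the round circle of a genus-one Lefschetz-free SBLF (equatorial round image,
torus-side pole `v`) the page Hessians of the height carry a continuous `1`-periodic timelike
field, then the fibration has the `S¹`-parametric fold normal form about its round circle
(the statement of `helper_sliceGluing_foldNormalForm`).  Composition of the landed layers
`helper_foldNF_periodicFrame_of_timelike`, `helper_foldNF_frame_of_periodicFrame`,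
`helper_foldNF_ofFrame`. [cite: BaykurKamada2015, §2] [cite: HirschDT1976, Ch. 6 §1] -/
theorem helper_foldNF_of_timelike : (∀ (X : Type) [TopologicalSpace X] [T2Space X] [SecondCountableTopology X] [CompactSpace X] [ChartedSpace (𝔼 4) X] [IsManifold (𝓡 4) ∞ X] (o : SmoothOrientation (𝓡 4) X) (f : X → 𝕊²), IsSimplifiedBrokenLefschetzFibration o f ∅ 0 → f '' ({p : X | ¬ Surjective (mfderiv (𝓡 4) (𝓡 2) f p)} \ (↑(∅ : Finset X) : Set X)) = sphereEquator 1 → ∀ (v : 𝕊²), (v : 𝔼 3) 0 = 0 → (v : 𝔼 3) 1 = 0 → (∀ y : 𝕊², ⟪(y : 𝔼 3), (v : 𝔼 3)⟫ < 0 → (∀ q, f q = y → Surjective (mfderiv (𝓡 4) (𝓡 2) f q)) ∧ Nonempty ((Fin (2 * 0) → ℤ) ≃ₗ[ℤ] singularHomology ℤ ℤ ↥(f ⁻¹' {y}) 1)) → (∀ y : 𝕊², ⟪(y : 𝔼 3), ((-v : 𝕊²) : 𝔼 3)⟫ < 0 → (∀ q, f q = y → Surjective (mfderiv (𝓡 4)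 (𝓡 2) f q)) ∧ Nonempty ((Fin (2 * (0 + 1)) → ℤ) ≃ₗ[ℤ] singularHomology ℤ ℤ ↥(f ⁻¹' {y}) 1)) → ∀ (e : Metric.sphere (0 : 𝔼 2) 1 → X) (ν₀ : CircleNbhd (𝓡 4) e), Set.range e = {p : X | ¬ Surjective (mfderiv (𝓡 4) (𝓡 2) f p)} \ (↑(∅ : Finset X) : Set X) → (∀ u, f (e u) = sphereInclusion 1 2 one_le_two u) → ∃ w : ℝ → 𝔼 3, Continuous w ∧ (∀ t : ℝ, w (t + 1) = w t) ∧ ∀ t : ℝ, fderiv ℝ (fderiv ℝ (fun q : ℝ × 𝔼 3 => SphereHeight.height (v : 𝔼 3) (f (ν₀.toFun (circlePt q.1, q.2))))) (t, 0) ((0 : ℝ), w t) ((0 : ℝ), w t) < 0) → ∀ (X : Type) [TopologicalSpace X] [T2Space X] [SecondCountableTopology X] [CompactSpace X] [ChartedSpace (𝔼 4) X] [IsManifold (𝓡 4) ∞ X] (o : SmoothOrientation (𝓡 4) X) (f : X → 𝕊²), IsSimplifiedBrokenLefschetzFibration o f ∅ 0 → f '' ({p : X | ¬ Surjective (mfderiv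 (𝓡 4) (𝓡 2) f p)} \ (↑(∅ : Finset X) : Set X)) = sphereEquator 1 → ∀ (v : 𝕊²), (v : 𝔼 3) 0 = 0 → (v : 𝔼 3) 1 = 0 → (∀ y : 𝕊², ⟪(y : 𝔼 3), (v : 𝔼 3)⟫ < 0 → (∀ q, f q = y → Surjective (mfderiv (𝓡 4) (𝓡 2) f q)) ∧ Nonempty ((Fin (2 * 0) → ℤ) ≃ₗ[ℤ] singularHomology ℤ ℤ ↥(f ⁻¹' {y}) 1)) → (∀ y : 𝕊², ⟪(y : 𝔼 3), ((-v : 𝕊²) : 𝔼 3)⟫ < 0 → (∀ q, f q = y → Surjective (mfderiv (𝓡 4) (𝓡 2) f q)) ∧ Nonempty ((Fin (2 * (0 + 1)) → ℤ) ≃ₗ[ℤ] singularHomology ℤ ℤ ↥(f ⁻¹' {y}) 1)) → ∃ (ε : ℝ) (ν : (Metric.sphere (0 : 𝔼 2) 1) × 𝔼 3 → X), 0 < ε ∧ ε < 1 ∧ ContMDiffOn ((𝓡 1).prod 𝓘(ℝ, 𝔼 3)) (𝓡 4) ∞ ν (Set.univ ×ˢ Metric.ball 0 ε) ∧ Set.InjOn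 ν (Set.univ ×ˢ Metric.ball 0 ε) ∧ IsOpen (ν '' (Set.univ ×ˢ Metric.ball 0 ε)) ∧ (∀ p : (Metric.sphere (0 : 𝔼 2) 1) × 𝔼 3, p.2 ∈ Metric.ball (0 : 𝔼 3) ε → Function.Injective (mfderiv ((𝓡 1).prod 𝓘(ℝ, 𝔼 3)) (𝓡 4) ν p)) ∧ (∀ q : X, ¬ Surjective (mfderiv (𝓡 4) (𝓡 2) f q) ↔ ∃ u, ν (u, 0) = q) ∧ (∀ (u : Metric.sphere (0 : 𝔼 2) 1) (x : 𝔼 3), x ∈ Metric.ball (0 : 𝔼 3) ε → ((f (ν (u, x)) : 𝕊²) : 𝔼 3) 0 = √(1 - (x 0 ^ 2 + x 1 ^ 2 - x 2 ^ 2) ^ 2) * (u : 𝔼 2) 0 ∧ ((f (ν (u, x)) : 𝕊²) : 𝔼 3) 1 = √(1 - (x 0 ^ 2 + x 1 ^ 2 - x 2 ^ 2) ^ 2) * (u : 𝔼 2) 1 ∧ ((f (ν (u, x)) : 𝕊²) : 𝔼 3) 2 = (v : 𝔼 3) 2 * (x 0 ^ 2 + x 1 ^ 2 - x 2 ^ 2))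 := by
  intro htl X _ _ _ _ _ _ o f hf hC v h0 h1 hlo hhi
  exact helper_foldNF_ofFrame X o f hf hC v h0 h1 hlo hhi
    (helper_foldNF_frame_of_periodicFrame (helper_foldNF_periodicFrame_of_timelike htl)
      X o f hf hC v h0 h1 hlo hhi)

end Summit.SmoothPoincare4.SmoothPoincare4.Cruxes.RungOne.Sketch

end
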